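import Summits.QuantumFields.BalabanUV.Beta.GAN24.StripLegVectors

/-!
# `BalabanUV.Beta.GAN24.StripLegVectorsRatio` — binder row G-an2-4 ∕ (CONV-C), lineage gan24-p3 (part P3, Woodbury ∕ fibre layer):
# **THE LEG VECTORS ON THE STRIP WITH THE RATIO-SHARP OFFSET FACTOR** — road P1's `StripLegVectors` (module F8 part 1 of row P1-L10) re-run with the
# leg-offset growth `exp(η·(M∕N)·Σ_i |ρ_i|)` in place of `exp(η·Σ_i |ρ_i|)`: the fine plane wave `e^{i k_m(p)·(Mρ)}`, `k_m(p) = (p + 2πm)∕N`, has modulus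
# `exp(−Σ_i (Im p_i∕N)·M·ρ_i) ≤ exp(η·(M∕N)·Σ_i |ρ_i|)` on `|Im p_i| ≤ η` — NO hypothesis `M ≤ N`, and at a box representative of the relative blocking
# `R = N∕M` (`0 ≤ ρ_i < R`) the factor is `≤ exp(η·D)`, FREE OF `R` (road P1 bounded `M∕N ≤ 1`, giving `exp(η·D·R)` downstream in `StripLegUnits.cstSq`)

NOT IN PRINT; OUR PROOF ([folklore] trigonometric bookkeeping over `ℂ`).  HONEST FRAMING (cell contract, verbatim): «discharging `BetaPertH` makes Bałaban's UV
stability UNCONDITIONAL — a real constructive-QFT result; it is NOT the continuum limit and NOT the Clay problem.»  HONEST DEPENDENCY (verbatim): «continuum YM on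
T⁴ ⇐ BetaPertH ∧ nine spine estimates (0/9 proved); BetaPertH ⇐ (D1) ∧ (D4) ∧ CAP+tail; G-an2-4 gates asym, D1 and NE2/3/4.»

WHY (located item «KPERF-TAIL-AMP» of `HOME/b2b-balaban-gan24-p3/WOODBURY-FIBRE.md` v9.1 row V19).  `GAN24/KPerfTailRate` (gen 15) proves that the perfect one-step
resolvent at base `n = Lc^m` decays at rate `δ₀∕n` with ONE `δ₀` for all `m`; its AMPLITUDE constant is road P1's (U2) constant `FibreStripOfRows.cstU … (Lc^m) …`,
whose factor `StripLegUnits.cstSq` contains `Real.exp (η·(4·Lc^m))^4` — exponential in `n`.  That exponential is NOT in the object: it enters ONLY through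
`StripAliasWeights.norm_cexp_offset_le`, which bounds `(Im p_i∕N)·M` by `η` using `M ≤ N` instead of by `η·M∕N`.  This module is LAYER 1 of the ratio-sharp
re-run (the remaining layers — `StripLegReadout`, `StripLegUnits(JM)`, `FibreStripJMHolds.legBound_jm_of_inv_bound` with the sharp factor — are mechanical and
listed in the census; after them the amplitude of `KPerfTailRate.decays_KPerf_uniformRate` is POLYNOMIAL in `n`).

CONTENT (generic `D`, `N ≥ 1`, any `M`; all [folklore]):
* §1 `abs_im_div_mul_le_ratio`, **`norm_cexp_offset_le_ratio`** ∕ `norm_cexp_neg_offset_le_ratio`: `‖e^{±i k_m(p)·(Mρ)}‖ ≤ exp(η·(M∕N)·Σ_i|ρ_i|)`;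
  `exp_offset_ratio_le_of_box`: if `M·|ρ_i| ≤ N` for all `i` then that factor is `≤ exp(η·D)`.
* §2 termwise: `norm_readW_sq_le_sinWt_ratio`, `norm_readW_sq_le_strip_ratio`, `norm_srcW_sq_le_sinWt_ratio`, `norm_srcW_sq_le_strip_ratio`, `norm_srcW_sq_le_strip'_ratio`
  — road P1's statements VERBATIM with the sharp factor (`0 < M ≤ N` kept where the `sinWt`∕`wMaj` majorants need it).
* §3 summed: **`sum_norm_readW_sq_le_strip_ratio`** (`Σ_m ‖readW‖² ≤ e_R(ρ)²·6^{D+1}·((N∕M)²)^D·5^D`), **`sum_weighted_norm_srcW_sq_le_strip_ratio`**.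
0 wall binders; nothing of (CONV-C) discharged; NEVER «G-an2-4 closed», NOT N7c, NOT D1, NOT BetaPertH, NOT continuum, NOT Clay.

ABSOLUTE RULE (cell, verbatim): «No internally-minted statement may enter as a cited fact. Every hypothesis is either kernel-proved in this package or a
verbatim quotation of a PUBLISHED theorem with page reference.»  Nothing is cited; no `def`; every input is a tree theorem imported BY NAME.
-/

noncomputable section

open Complex Finset
open scoped BigOperators Real
open Literature.Probability.LatticeModels (TorusSite)
open Literature.MathematicalPhysics.QuantumFieldTheory
open Literature.MathematicalPhysics.QuantumFieldTheory.Balaban1983to89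
open B4Strip (reVec)
open Summit.QuantumFields.BalabanUV.Beta.GAN24.AliasWeights
  (sinWt sinWt_pos sinWt_le_one kfine wMaj wMaj_nonneg wMaj_zero sinWt_kfine_le_wMaj sinWt_le_sq_mul_sinWt)
open Summit.QuantumFields.BalabanUV.Beta.GAN24.AliasWeightsSum (sum_prod_wMaj_le)
open Summit.QuantumFields.BalabanUV.Beta.GAN24.AliasObjects (kAl readW srcW sMAl SMAl sbMAl SbMAl)
open Summit.QuantumFields.BalabanUV.Beta.GAN24.StripAliasWeights
  (norm_sMAl_sq_le_strip norm_SMAl_sq_le_strip norm_sbMAl_sq_le_strip norm_SbMAl_sq_le_strip norm_cexp_offset_eq)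
open Summit.QuantumFields.BalabanUV.Beta.GAN24.StripLegVectors (prod_wMaj_nonneg prod_sinWt_le_wMaj core_sq_le sum_prod_wMaj_le_five_pow)

namespace Summit.QuantumFields.BalabanUV.Beta.GAN24.StripLegVectorsRatio

variable {D : ℕ} {N : ℕ} [NeZero N]

/-! ## §1 The ratio-sharp offset factor -/

section Offset

variable {p : Fin D → ℂ} {η : ℝ}

/-- [folklore] `|(Im p_κ)∕N|·M ≤ η·(M∕N)` on `|Im p_κ| ≤ η` — NO `M ≤ N`. -/
theorem abs_im_div_mul_le_ratio (him : ∀ i, |(p i).im| ≤ η) (κ : Fin D) (M : ℕ) : |(p κ).im / N| * M ≤ η * ((M : ℝ) / N) := by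
  have hN : (0 : ℝ) < N := by exact_mod_cast Nat.pos_of_ne_zero (NeZero.ne N)
  rw [abs_div, Nat.abs_cast]
  have h1 : |(p κ).im| / N * M = |(p κ).im| * ((M : ℝ) / N) := by ring
  rw [h1]
  exact mul_le_mul_of_nonneg_right (him κ) (by positivity)

/-- [folklore] **THE RATIO-SHARP OFFSET PHASE**: `‖e^{i k_m(p)·(Mρ)}‖ ≤ exp(η·(M∕N)·Σ_i |ρ_i|)` on the strip `|Im p_i| ≤ η` (any `M`). -/
theorem norm_cexp_offset_le_ratio (him : ∀ i, |(p i).im| ≤ η) (M : ℕ) (m : TorusSite D N) (ρ : Fin D → ℤ) :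
    ‖cexp (I * ∑ i, kAl N p m i * ((M : ℂ) * (ρ i : ℂ)))‖ ≤ Real.exp (η * ((M : ℝ) / N) * ∑ i, |(ρ i : ℝ)|) := by
  rw [norm_cexp_offset_eq, Finset.mul_sum]
  refine Real.exp_le_exp.2 ?_
  rw [← Finset.sum_neg_distrib]
  refine Finset.sum_le_sum fun i _ => ?_
  have h1 : |(p i).im / N * ((M : ℝ) * (ρ i : ℝ))| ≤ η * ((M : ℝ) / N) * |(ρ i : ℝ)| := by
    rw [← mul_assoc, abs_mul, abs_mul, Nat.abs_cast]
    exact mul_le_mul_of_nonneg_right (abs_im_div_mul_le_ratio him i M) (abs_nonneg _)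
  have := neg_abs_le ((p i).im / N * ((M : ℝ) * (ρ i : ℝ)))
  linarith

/-- [folklore] The flat offset phase: `‖e^{−i k_m(p)·(Mρ)}‖ ≤ exp(η·(M∕N)·Σ_i |ρ_i|)` likewise. -/
theorem norm_cexp_neg_offset_le_ratio (him : ∀ i, |(p i).im| ≤ η) (M : ℕ) (m : TorusSite D N) (ρ : Fin D → ℤ) :
    ‖cexp (-(I * ∑ i, kAl N p m i * ((M : ℂ) * (ρ i : ℂ))))‖ ≤ Real.exp (η * ((M : ℝ) / N) * ∑ i, |(ρ i : ℝ)|) := by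
  have h := norm_cexp_offset_le_ratio him M m (fun i => -ρ i)
  have hsum : (∑ i, kAl N p m i * ((M : ℂ) * ((-ρ i : ℤ) : ℂ))) = -∑ i, kAl N p m i * ((M : ℂ) * (ρ i : ℂ)) := by
    rw [← Finset.sum_neg_distrib]
    exact Finset.sum_congr rfl fun i _ => by push_cast; ring
  rw [hsum, mul_neg] at h
  have habs : (∑ i, |((-ρ i : ℤ) : ℝ)|) = ∑ i, |(ρ i : ℝ)| := Finset.sum_congr rfl fun i _ => by push_cast; rw [abs_neg]
  rwa [habs] at h

omit [NeZero N] in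
/-- [folklore] **AT A BOX REPRESENTATIVE OF THE RELATIVE BLOCKING THE FACTOR IS `R`-FREE**: if `M·|ρ_i| ≤ N` for every `i` (e.g. `0 ≤ ρ_i < N∕M`) and `0 ≤ η`,
then `exp(η·(M∕N)·Σ_i |ρ_i|) ≤ exp(η·D)`. -/
theorem exp_offset_ratio_le_of_box (hN : 0 < N) (hη : 0 ≤ η) {M : ℕ} {ρ : Fin D → ℤ} (hρ : ∀ i, (M : ℝ) * |(ρ i : ℝ)| ≤ N) :
    Real.exp (η * ((M : ℝ) / N) * ∑ i, |(ρ i : ℝ)|) ≤ Real.exp (η * D) := by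
  have hNr : (0 : ℝ) < N := by exact_mod_cast hN
  refine Real.exp_le_exp.2 ?_
  rw [mul_assoc]
  refine mul_le_mul_of_nonneg_left ?_ hη
  rw [Finset.mul_sum]
  calc ∑ i, (M : ℝ) / N * |(ρ i : ℝ)| ≤ ∑ _i : Fin D, (1 : ℝ) := by
        refine Finset.sum_le_sum fun i _ => ?_
        rw [div_mul_eq_mul_div, div_le_one hNr]
        exact hρ i
    _ = D := by simp

end Offset

/-! ## §2 Termwise strip bounds of the reading ∕ source weights with the sharp factor -/

section Termwise

variable {p : Fin D → ℂ} {η : ℝ}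

/-- [folklore] READING WEIGHT ON THE STRIP, sinWt form, sharp factor: `‖readW N M p m κ ρ‖² ≤ e_R(ρ)²·6^{D+1}·Π_i sinWt M x_i`,
`e_R(ρ) = exp(η·(M∕N)·Σ|ρ_i|)` (`|Im p_i| ≤ η ≤ 1∕4`, `0 < M ≤ N`). -/
theorem norm_readW_sq_le_sinWt_ratio (him : ∀ i, |(p i).im| ≤ η) (hη : 0 ≤ η) (hη4 : η ≤ 1 / 4) {M : ℕ} (hM : 0 < M) (hMN : M ≤ N)
    (m : TorusSite D N) (κ : Fin D) (ρ : Fin D → ℤ) :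
    ‖readW N M p m κ ρ‖ ^ 2 ≤ Real.exp (η * ((M : ℝ) / N) * ∑ i, |(ρ i : ℝ)|) ^ 2 * ((6 : ℝ) ^ (D + 1) * ∏ i, sinWt M (kfine N (reVec p) m i)) := by
  set P : ℝ := ∏ i, sinWt M (kfine N (reVec p) m i) with hPdef
  have hP : 0 ≤ P := Finset.prod_nonneg fun i _ => (sinWt_pos _ _).le
  have hE := norm_cexp_offset_le_ratio him M m ρ
  have hS := norm_SMAl_sq_le_strip him hη hη4 hMN m
  have hs : ‖sMAl N M p m κ‖ ^ 2 ≤ 6 * (M : ℝ) ^ 2 :=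
    (norm_sMAl_sq_le_strip him hη hη4 hMN m κ).trans (mul_le_of_le_one_right (by positivity) (sinWt_le_one _ _))
  have hnorm : ‖readW N M p m κ ρ‖ =
      ‖cexp (I * ∑ i, kAl N p m i * ((M : ℂ) * (ρ i : ℂ)))‖ * ‖SMAl N M p m‖ * ‖sMAl N M p m κ‖ / (M : ℝ) ^ (D + 1) := by
    unfold readW
    rw [norm_div, norm_mul, norm_mul, norm_pow, Complex.norm_natCast]
  rw [hnorm]
  exact core_sq_le hM hE hS hs hP

/-- [folklore] READING WEIGHT ON THE STRIP, alias-majorant form, sharp factor: `‖readW N M p m κ ρ‖² ≤ e_R(ρ)²·6^{D+1}·((N∕M)²)^D·Π_i wMaj N (m i)`. -/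
theorem norm_readW_sq_le_strip_ratio (him : ∀ i, |(p i).im| ≤ η) (hre : ∀ i, |(p i).re| ≤ π) (hη : 0 ≤ η) (hη4 : η ≤ 1 / 4)
    {M : ℕ} (hM : 0 < M) (hMN : M ≤ N) (m : TorusSite D N) (κ : Fin D) (ρ : Fin D → ℤ) :
    ‖readW N M p m κ ρ‖ ^ 2 ≤
      Real.exp (η * ((M : ℝ) / N) * ∑ i, |(ρ i : ℝ)|) ^ 2 * ((6 : ℝ) ^ (D + 1) * ((((N : ℝ) / M) ^ 2) ^ D * ∏ i, wMaj N (m i))) := by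
  refine (norm_readW_sq_le_sinWt_ratio him hη hη4 hM hMN m κ ρ).trans ?_
  exact mul_le_mul_of_nonneg_left (mul_le_mul_of_nonneg_left (prod_sinWt_le_wMaj hre hM hMN m) (by positivity)) (sq_nonneg _)

/-- [folklore] SOURCE WEIGHT ON THE STRIP, sinWt form, sharp factor: `‖N^D · srcW N M p m κ ρ‖² ≤ e_R(ρ)²·6^{D+1}·Π_i sinWt M x_i`. -/
theorem norm_srcW_sq_le_sinWt_ratio (him : ∀ i, |(p i).im| ≤ η) (hη : 0 ≤ η) (hη4 : η ≤ 1 / 4) {M : ℕ} (hM : 0 < M) (hMN : M ≤ N)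
    (m : TorusSite D N) (κ : Fin D) (ρ : Fin D → ℤ) :
    ‖(N : ℂ) ^ D * srcW N M p m κ ρ‖ ^ 2 ≤
      Real.exp (η * ((M : ℝ) / N) * ∑ i, |(ρ i : ℝ)|) ^ 2 * ((6 : ℝ) ^ (D + 1) * ∏ i, sinWt M (kfine N (reVec p) m i)) := by
  set P : ℝ := ∏ i, sinWt M (kfine N (reVec p) m i) with hPdef
  have hP : 0 ≤ P := Finset.prod_nonneg fun i _ => (sinWt_pos _ _).le
  have hE := norm_cexp_neg_offset_le_ratio him M m ρ
  have hS := norm_SbMAl_sq_le_strip him hη hη4 hMN m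
  have hs : ‖sbMAl N M p m κ‖ ^ 2 ≤ 6 * (M : ℝ) ^ 2 :=
    (norm_sbMAl_sq_le_strip him hη hη4 hMN m κ).trans (mul_le_of_le_one_right (by positivity) (sinWt_le_one _ _))
  have hN : ((N : ℂ) ^ D) ≠ 0 := pow_ne_zero _ (Nat.cast_ne_zero.2 (NeZero.ne N))
  have hnorm : ‖(N : ℂ) ^ D * srcW N M p m κ ρ‖ =
      ‖cexp (-(I * ∑ i, kAl N p m i * ((M : ℂ) * (ρ i : ℂ))))‖ * ‖SbMAl N M p m‖ * ‖sbMAl N M p m κ‖ / (M : ℝ) ^ (D + 1) := by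
    unfold srcW
    rw [mul_div_cancel₀ _ hN, norm_div, norm_mul, norm_mul, norm_pow, Complex.norm_natCast]
  rw [hnorm]
  exact core_sq_le hM hE hS hs hP

/-- [folklore] SOURCE WEIGHT ON THE STRIP, alias-majorant form, sharp factor. -/
theorem norm_srcW_sq_le_strip_ratio (him : ∀ i, |(p i).im| ≤ η) (hre : ∀ i, |(p i).re| ≤ π) (hη : 0 ≤ η) (hη4 : η ≤ 1 / 4)
    {M : ℕ} (hM : 0 < M) (hMN : M ≤ N) (m : TorusSite D N) (κ : Fin D) (ρ : Fin D → ℤ) :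
    ‖(N : ℂ) ^ D * srcW N M p m κ ρ‖ ^ 2 ≤
      Real.exp (η * ((M : ℝ) / N) * ∑ i, |(ρ i : ℝ)|) ^ 2 * ((6 : ℝ) ^ (D + 1) * ((((N : ℝ) / M) ^ 2) ^ D * ∏ i, wMaj N (m i))) := by
  refine (norm_srcW_sq_le_sinWt_ratio him hη hη4 hM hMN m κ ρ).trans ?_
  exact mul_le_mul_of_nonneg_left (mul_le_mul_of_nonneg_left (prod_sinWt_le_wMaj hre hM hMN m) (by positivity)) (sq_nonneg _)

/-- [folklore] The un-multiplied source weight with the sharp factor. -/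
theorem norm_srcW_sq_le_strip'_ratio (him : ∀ i, |(p i).im| ≤ η) (hre : ∀ i, |(p i).re| ≤ π) (hη : 0 ≤ η) (hη4 : η ≤ 1 / 4)
    {M : ℕ} (hM : 0 < M) (hMN : M ≤ N) (m : TorusSite D N) (κ : Fin D) (ρ : Fin D → ℤ) :
    ‖srcW N M p m κ ρ‖ ^ 2 ≤
      Real.exp (η * ((M : ℝ) / N) * ∑ i, |(ρ i : ℝ)|) ^ 2 * ((6 : ℝ) ^ (D + 1) * ((((N : ℝ) / M) ^ 2) ^ D * ∏ i, wMaj N (m i))) /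
        (((N : ℝ) ^ D) ^ 2) := by
  have hN : (0 : ℝ) < (N : ℝ) ^ D := pow_pos (by exact_mod_cast Nat.pos_of_ne_zero (NeZero.ne N)) _
  have h := norm_srcW_sq_le_strip_ratio him hre hη hη4 hM hMN m κ ρ
  rw [norm_mul, norm_pow, Complex.norm_natCast, mul_pow] at h
  rw [le_div_iff₀ (pow_pos hN 2)]
  linarith [h]

end Termwise

/-! ## §3 Summed over the aliases, sharp factor -/

section Summed

variable {p : Fin D → ℂ} {η : ℝ}

/-- [folklore] **THE READING `ℓ²`-SUM ON THE STRIP, sharp factor**: `Σ_m ‖readW N M p m κ ρ‖² ≤ e_R(ρ)²·6^{D+1}·((N∕M)²)^D·5^D`. -/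
theorem sum_norm_readW_sq_le_strip_ratio (him : ∀ i, |(p i).im| ≤ η) (hre : ∀ i, |(p i).re| ≤ π) (hη : 0 ≤ η) (hη4 : η ≤ 1 / 4)
    {M : ℕ} (hM : 0 < M) (hMN : M ≤ N) (κ : Fin D) (ρ : Fin D → ℤ) :
    ∑ m : TorusSite D N, ‖readW N M p m κ ρ‖ ^ 2 ≤
      Real.exp (η * ((M : ℝ) / N) * ∑ i, |(ρ i : ℝ)|) ^ 2 * ((6 : ℝ) ^ (D + 1) * ((((N : ℝ) / M) ^ 2) ^ D * (5 : ℝ) ^ D)) := by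
  calc ∑ m : TorusSite D N, ‖readW N M p m κ ρ‖ ^ 2
      ≤ ∑ m : TorusSite D N, Real.exp (η * ((M : ℝ) / N) * ∑ i, |(ρ i : ℝ)|) ^ 2 *
          ((6 : ℝ) ^ (D + 1) * ((((N : ℝ) / M) ^ 2) ^ D * ∏ i, wMaj N (m i))) :=
        Finset.sum_le_sum fun m _ => norm_readW_sq_le_strip_ratio him hre hη hη4 hM hMN m κ ρ
    _ = Real.exp (η * ((M : ℝ) / N) * ∑ i, |(ρ i : ℝ)|) ^ 2 *
          ((6 : ℝ) ^ (D + 1) * ((((N : ℝ) / M) ^ 2) ^ D * ∑ m : TorusSite D N, ∏ i, wMaj N (m i))) := by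
        rw [← Finset.mul_sum, ← Finset.mul_sum, ← Finset.mul_sum]
    _ ≤ Real.exp (η * ((M : ℝ) / N) * ∑ i, |(ρ i : ℝ)|) ^ 2 * ((6 : ℝ) ^ (D + 1) * ((((N : ℝ) / M) ^ 2) ^ D * (5 : ℝ) ^ D)) := by
        gcongr
        exact sum_prod_wMaj_le_five_pow

/-- [folklore] **THE ROW-WEIGHTED SOURCE `ℓ²`-SUM ON THE STRIP, sharp factor**: for row weights `w` with `0 ≤ w m ≤ W` off the zero alias,
`Σ_m (w m)²·‖N^D·srcW N M p m κ ρ‖² ≤ e_R(ρ)²·6^{D+1}·((N∕M)²)^D·((w 0)² + W²·(5^D − 1))`. -/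
theorem sum_weighted_norm_srcW_sq_le_strip_ratio (him : ∀ i, |(p i).im| ≤ η) (hre : ∀ i, |(p i).re| ≤ π) (hη : 0 ≤ η) (hη4 : η ≤ 1 / 4)
    {M : ℕ} (hM : 0 < M) (hMN : M ≤ N) (κ : Fin D) (ρ : Fin D → ℤ) (w : TorusSite D N → ℝ) {W : ℝ}
    (hw : ∀ m, m ≠ 0 → 0 ≤ w m ∧ w m ≤ W) :
    ∑ m : TorusSite D N, w m ^ 2 * ‖(N : ℂ) ^ D * srcW N M p m κ ρ‖ ^ 2 ≤
      Real.exp (η * ((M : ℝ) / N) * ∑ i, |(ρ i : ℝ)|) ^ 2 * ((6 : ℝ) ^ (D + 1) * (((N : ℝ) / M) ^ 2) ^ D) *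
        (w 0 ^ 2 + W ^ 2 * ((5 : ℝ) ^ D - 1)) := by
  classical
  set K : ℝ := Real.exp (η * ((M : ℝ) / N) * ∑ i, |(ρ i : ℝ)|) ^ 2 * ((6 : ℝ) ^ (D + 1) * (((N : ℝ) / M) ^ 2) ^ D) with hK
  have hK0 : 0 ≤ K := by positivity
  have hterm : ∀ m : TorusSite D N, w m ^ 2 * ‖(N : ℂ) ^ D * srcW N M p m κ ρ‖ ^ 2 ≤ K * (w m ^ 2 * ∏ i, wMaj N (m i)) := by
    intro m
    have h := norm_srcW_sq_le_strip_ratio him hre hη hη4 hM hMN m κ ρ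
    calc w m ^ 2 * ‖(N : ℂ) ^ D * srcW N M p m κ ρ‖ ^ 2
        ≤ w m ^ 2 * (Real.exp (η * ((M : ℝ) / N) * ∑ i, |(ρ i : ℝ)|) ^ 2 *
            ((6 : ℝ) ^ (D + 1) * ((((N : ℝ) / M) ^ 2) ^ D * ∏ i, wMaj N (m i)))) :=
          mul_le_mul_of_nonneg_left h (sq_nonneg _)
      _ = K * (w m ^ 2 * ∏ i, wMaj N (m i)) := by rw [hK]; ring
  have hsplit := Finset.sum_erase_add (Finset.univ : Finset (TorusSite D N)) (fun m => w m ^ 2 * ∏ i, wMaj N (m i)) (Finset.mem_univ 0)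
  have h0 : w 0 ^ 2 * ∏ i : Fin D, wMaj N ((0 : TorusSite D N) i) = w 0 ^ 2 := by simp
  have hoff : ∑ m ∈ (Finset.univ : Finset (TorusSite D N)).erase 0, w m ^ 2 * ∏ i, wMaj N (m i) ≤ W ^ 2 * ((5 : ℝ) ^ D - 1) := by
    calc ∑ m ∈ (Finset.univ : Finset (TorusSite D N)).erase 0, w m ^ 2 * ∏ i, wMaj N (m i)
        ≤ ∑ m ∈ (Finset.univ : Finset (TorusSite D N)).erase 0, W ^ 2 * ∏ i, wMaj N (m i) := by
          refine Finset.sum_le_sum fun m hm => ?_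
          have hm0 : m ≠ 0 := (Finset.mem_erase.1 hm).1
          exact mul_le_mul_of_nonneg_right (pow_le_pow_left₀ (hw m hm0).1 (hw m hm0).2 2) (prod_wMaj_nonneg m)
      _ = W ^ 2 * ∑ m ∈ (Finset.univ : Finset (TorusSite D N)).erase 0, ∏ i, wMaj N (m i) := by rw [Finset.mul_sum]
      _ ≤ W ^ 2 * ((5 : ℝ) ^ D - 1) := mul_le_mul_of_nonneg_left (sum_prod_wMaj_le N) (sq_nonneg _)
  have hmaj : ∑ m : TorusSite D N, w m ^ 2 * ∏ i, wMaj N (m i) ≤ w 0 ^ 2 + W ^ 2 * ((5 : ℝ) ^ D - 1) := by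
    rw [← hsplit, h0]
    linarith
  calc ∑ m : TorusSite D N, w m ^ 2 * ‖(N : ℂ) ^ D * srcW N M p m κ ρ‖ ^ 2
      ≤ ∑ m : TorusSite D N, K * (w m ^ 2 * ∏ i, wMaj N (m i)) := Finset.sum_le_sum fun m _ => hterm m
    _ = K * ∑ m : TorusSite D N, w m ^ 2 * ∏ i, wMaj N (m i) := by rw [Finset.mul_sum]
    _ ≤ K * (w 0 ^ 2 + W ^ 2 * ((5 : ℝ) ^ D - 1)) := mul_le_mul_of_nonneg_left hmaj hK0

end Summed

end Summit.QuantumFields.BalabanUV.Beta.GAN24.StripLegVectorsRatio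

end
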